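import Literature.AlgebraicGeometry.Hyperkaehler.K3HilbertSquareTypeCohomology
import Literature.AlgebraicGeometry.HodgeTheory.HodgeIndexOneOneLefschetzForm
import Literature.AlgebraicGeometry.HodgeTheory.HodgeTypeConjugation
import Literature.AlgebraicGeometry.HodgeTheory.WeilClassesDescendingTransfer
import Summits.HodgeConjecture.HodgeConjecture.Theorems.NikulinTwinTransportRealMultiplicationGForm

/-!
# Route MarkmanPartnerTransport · support `PartnerExistence` (stmt-HodgeConjecture-19655) —
# BEAUVILLE–FUJIKI POSITIVITY for marked `K3^{[2]}`-type fourfolds: `q(κ) > 0` on the Kähler class,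
# from the Hodge–Riemann relations of the tree and the polarised Fujiki relation

For a smooth projective fourfold `X` with a marking `(φ, P, z)` satisfying the clauses (m1)–(m6) of the
routes' `MarkedK3Sq` (integral generator `P` of `H⁸`, integral lattice via `φ : H²(X(ℂ);ℂ) ≅ ℂ^{23}`, Fujiki
`a⁴ = 3 q(φa)² P`, period `z` spanning `H^{2,0}`, `H^{1,1} = ⟨z, z̄⟩^{⊥_q}`, `q(z) = 0 < Re q(z̄, z)`) and a
Kähler–rational datum `D` of `X` (tree: `nonempty_kaehlerRationalDatum`; Kähler class `κ = H_η`), we PROVE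
* **`cTrace_pos_and_kaehler_pos`** — the datum's trace of the marking generator is a positive real,
  `τ(P) > 0`, AND `q(φκ, φκ)` is a positive real: THE BEAUVILLE–FUJIKI POSITIVITY of the
  Beauville–Bogomolov form on a Kähler class (Beauville 1983 Thm. 5; Huybrechts 1999 1.9–1.10), derived in
  the kernel from the second Hodge–Riemann relation of the tree (`KaehlerRationalDatum.hodgeRiemann_X`) for
  the `(2,0)`-class `σ = φ⁻¹z` (`∫ κ²σσ̄ > 0`) and for `σ² ∈ H^{4,0}` (`∫ σ²σ̄² > 0`), and the polarised
  Fujiki relation (`cupFour_eq_of_isMarkedK3Hilb`): `κ²σσ̄ = q(κ)q(σ,σ̄)P`, `σ²σ̄² = 2q(σ,σ̄)²P`;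
* `k3HilbertForm_self_neg_of_oneOne_of_kaehler_orthogonal` — **Hodge index for `q`**: a non-zero real
  `(1,1)`-class `d` with `q(φκ, φd) = 0` has `q(φd, φd) < 0` (`d` is `κ`-primitive since
  `κ³d = 3q(κ)q(κ,d)P = 0`; Hodge–Riemann gives `∫ κ²d² < 0`, and `κ²d² = q(κ)q(d,d)P`). Hence `q` is
  negative definite on `κ^{⊥_q} ∩ H^{1,1}_ℝ` and NON-DEGENERATE of signature `(1, ρ−1)` on `N¹(X)`.
This is the positivity that `PartnerExistence` (stmt-19655) silently needs (evidence #1/#2 on that item): with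
it `q` is non-degenerate of signature `(1, ρ−1)` on `N¹(X)` and of signature `(2, 21−ρ)` on `T(X)`.

No definition, no sorry, no named fact (the Hodge–Riemann relations, the existence of Kähler–rational data and
the polarised Fujiki relation are theorems of the tree); route-independent. Prover seat hodge-nonav-19652-p1
(gen 5), `--supports stmt-HodgeConjecture-19655`.

References: A. Beauville, J. Differential Geom. 18 (1983) §8 Thm. 5; D. Huybrechts, Invent. Math. 135
(1999) 1.9–1.11; C. Voisin, *Hodge Theory I*, §6.3.2 Thm. 6.32; K. O'Grady, §2.2 (polarised Fujiki).
-/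

noncomputable section

set_option linter.dupNamespace false

open Module CategoryTheory
open Literature.AlgebraicTopology.SingularHomology Literature.Geometry.Kaehler
open Literature.AlgebraicGeometry Literature.AlgebraicGeometry.Motives Literature.AlgebraicGeometry.HodgeTheory
open Literature.AlgebraicGeometry.Hyperkaehler Literature.AlgebraicGeometry.Surfaces
open Summit.HodgeConjecture.HodgeConjecture.Theorems.NikulinTwinTransport

namespace Summit.HodgeConjecture.HodgeConjecture.Theorems.MarkmanPartnerTransport.BBFPositivity

variable {X : SchemeOver ℂ}

/-- `MarkedK3Sq[X, φ, P, z]`: VERBATIM the `let MarkedK3Sq := …` binder of the route declarations of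
MarkmanPartnerTransport (clauses (m1)–(m6)). Local notation only. -/
local notation3 (prettyPrint := false) "MarkedK3Sq[" X ", " φ ", " P ", " z "]" =>
  (((IsIntegralClass P ∧ ∀ Q : complexBetti X (2 * 4), IsIntegralClass Q → ∃ n : ℤ, Q = n • P) ∧
    (∀ c : complexBetti X 2, IsIntegralClass c ↔ ∃ v : K3HilbertIndex → ℤ, φ c = fun i => (v i : ℂ)) ∧
    (∀ a : complexBetti X 2, cupPowTwo a 4 = ((3 : ℂ) * (k3HilbertForm 2 (φ a) (φ a)) ^ 2) • P) ∧
    (IsOfHodgeType 4 X 2 2 0 (LinearEquiv.symm φ z) ∧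
      ∀ τ : complexBetti X 2, IsOfHodgeType 4 X 2 2 0 τ → ∃ t : ℂ, τ = t • LinearEquiv.symm φ z) ∧
    (∀ c : complexBetti X 2, IsOfHodgeType 4 X 2 1 1 c ↔
      (k3HilbertForm 2 (φ c) z = 0 ∧ k3HilbertForm 2 (φ c) (star z) = 0)) ∧
    (k3HilbertForm 2 z z = 0 ∧ 0 < (k3HilbertForm 2 (star z) z).re)))

/-! ### The marking is a marked `K3^{[2]}` lattice in the sense of `IsMarkedK3Hilb` -/

/-- Clauses (m1)–(m3) are `IsMarkedK3Hilb 2 X φ P` (`3!! = 3`). [cite: Markman2024, §1.3 Step 1] -/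
theorem isMarkedK3Hilb_of_marked {φ : complexBetti X 2 ≃ₗ[ℂ] (K3HilbertIndex → ℂ)}
    {P : complexBetti X (2 * 4)} {z : K3HilbertIndex → ℂ} (hM : MarkedK3Sq[X, φ, P, z]) :
    IsMarkedK3Hilb 2 X φ P := by
  obtain ⟨hP, hint, hfuj, -⟩ := hM
  refine ⟨hP, hint, fun a ↦ ?_⟩
  have h3 : ((Nat.doubleFactorial (2 * 2 - 1) : ℕ) : ℂ) = 3 := by norm_num [Nat.doubleFactorial]
  rw [h3]
  exact hfuj a

/-! ### Classes of type `(p, q)` with `p > 4` or `q > 4` vanish on a fourfold -/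

/-- No classes of type `(p, q)` with `p > 4` on a fourfold. [cite: VoisinHodgeI2002, §6.1] -/
theorem eq_zero_of_isOfHodgeType_of_four_lt (hX : IsSmoothProjective 4 X) {k p q : ℕ} (hpqk : p + q = k)
    (hp : 4 < p) {c : complexBetti X k} (hc : IsOfHodgeType 4 X k p q c) : c = 0 := by
  set A := BettiUniverse.realHodgeModel exists_isReal_hodgeModel_holds hX
  have hmem := A.mem_typePiece_of_isOfHodgeType hodgePQ_independent_of_hodgeModel_holds hX
    (Finset.HasAntidiagonal.mem_antidiagonal.2 hpqk) hc
  rwa [A.typePiece_eq_bot_of_lt_fst _ hp, Submodule.mem_bot] at hmem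

/-! ### The Lefschetz iterate in the `cupFour` spelling -/

/-- `L²_κ a ∪ b = cupFour κ κ a b` (`L² a = κ ∪ (κ ∪ a)`; associativity of the cup product).
[cite: HatcherAT2002, §3.2 p. 211] -/
theorem cupProduct_lefschetzPow_two_eq_cupFour (κ a b : complexBetti X 2) :
    cupProduct (show (2 + 2 * 2) + 2 = 2 * 4 by norm_num) (lefschetzPow κ 2 2 a) b = cupFour κ κ a b := by
  rw [cupFour_def]
  congr 1
  simp only [lefschetzPow_succ, lefschetzPow_zero, LinearMap.comp_apply, LinearMap.id_apply,
    lefschetzOperator_apply]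
  rw [cupProduct_assoc (rfl : 2 + 2 = 2 * 2) (show 2 + 2 = 2 + 2 * 1 by norm_num) (rfl : 2 * 2 + 2 = 2 * 3)
    (show 2 + (2 + 2 * 1) = 2 * 3 by norm_num) κ κ a]

/-! ### Reality: the marking, the form, the period -/

/-- `star (q(a, b)) = q(ā, b̄)` for the `K3^{[2]}` form (integral Gram matrix). [folklore] -/
theorem star_k3HilbertForm (a b : K3HilbertIndex → ℂ) :
    star (k3HilbertForm 2 a b) = k3HilbertForm 2 (star a) (star b) := by
  simp only [k3HilbertForm, star_sum, star_mul', star_intCast, Pi.star_apply]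

/-- `q(z, z̄)` is real: it is its own conjugate (symmetry of `q`). [folklore] -/
theorem k3HilbertForm_self_star_im (z : K3HilbertIndex → ℂ) : (k3HilbertForm 2 z (star z)).im = 0 := by
  have h : star (k3HilbertForm 2 z (star z)) = k3HilbertForm 2 z (star z) := by
    rw [star_k3HilbertForm, star_star, k3HilbertForm_comm]
  rw [← starRingEnd_apply] at h
  exact Complex.conj_eq_iff_im.mp h

/-- On real coordinate vectors (`ā = a`) the form takes real values. [folklore] -/
theorem k3HilbertForm_im_eq_zero_of_star_eq {a b : K3HilbertIndex → ℂ} (ha : star a = a) (hb : star b = b) :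
    (k3HilbertForm 2 a b).im = 0 := by
  have h : star (k3HilbertForm 2 a b) = k3HilbertForm 2 a b := by rw [star_k3HilbertForm, ha, hb]
  rw [← starRingEnd_apply] at h
  exact Complex.conj_eq_iff_im.mp h

/-- Under an integral marking, complex conjugation of classes is conjugation of coordinates:
`φ(conj c) = star (φ c)`. [cite: VoisinHodgeI2002, Cor. 6.12] -/
theorem marking_conjClass {φ : complexBetti X 2 ≃ₗ[ℂ] (K3HilbertIndex → ℂ)}
    (hint : ∀ c : complexBetti X 2, IsIntegralClass c ↔ ∃ v : K3HilbertIndex → ℤ, φ c = fun i => (v i : ℂ))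
    (c : complexBetti X 2) : φ (conjClass (ComplexPoints X) 2 c) = star (φ c) := by
  have h := conjClass_integralMarking_symm (S := X) φ hint (φ c)
  rw [LinearEquiv.symm_apply_apply] at h
  rw [h, LinearEquiv.apply_symm_apply]

/-! ### Hodge–Riemann for the period: `κ² σ σ̄` is a positive multiple of the volume class -/

/-- **`∫ κ² σ σ̄ > 0`**: for the `(2,0)`-class `σ = φ⁻¹z` of a marked `X` and the Kähler class `κ = H_η`
of a Kähler–rational datum, `cupFour κ κ σ σ̄ = t·Ω` with `t > 0` (the tree's second Hodge–Riemann relation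
`KaehlerRationalDatum.hodgeRiemann_X` at `a = 2`, type `(2,0)`, `r₀ = 2`; `σ` is primitive because
`κ³σ` has type `(5,3)`). [cite: VoisinHodgeI2002, §6.3.2 Thm. 6.32] -/
theorem cupFour_kaehler_period (hX : IsSmoothProjective 4 X)
    {φ : complexBetti X 2 ≃ₗ[ℂ] (K3HilbertIndex → ℂ)} {P : complexBetti X (2 * 4)} {z : K3HilbertIndex → ℂ}
    (hM : MarkedK3Sq[X, φ, P, z]) (D : KaehlerRationalDatum 4 X) :
    ∃ t : ℝ, 0 < t ∧ cupFour D.Hη D.Hη (φ.symm z) (conjClass (ComplexPoints X) 2 (φ.symm z)) =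
      (t : ℂ) • D.topClass := by
  obtain ⟨-, -, -, hper, -, hzz⟩ := hM
  have hz20 : IsOfHodgeType 4 X 2 2 0 (φ.symm z) := hper.1
  have hzpos : 0 < (k3HilbertForm 2 (star z) z).re := hzz.2
  have hCPT := BettiUniverse.cupPreservesHodgeType exists_isReal_hodgeModel_holds
    hodgePQ_independent_of_hodgeModel_holds hX
  have hκ11 : IsOfHodgeType 4 X 2 1 1 D.Hη := D.isOfHodgeType_Hη
  have hσ0 : φ.symm z ≠ 0 := by
    intro h0
    have hz : z = 0 := by simpa using congrArg φ h0
    rw [hz, star_zero] at hzpos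
    simp [k3HilbertForm] at hzpos
  -- `σ` is primitive: `L³ σ = κ ∪ (κ ∪ (κ ∪ σ))` has type `(5,3)`, hence vanishes
  have hprim : lefschetzPow D.Hη (2 + 1) 2 (φ.symm z) = 0 := by
    simp only [lefschetzPow_succ, lefschetzPow_zero, LinearMap.comp_apply, LinearMap.id_apply,
      lefschetzOperator_apply]
    exact eq_zero_of_isOfHodgeType_of_four_lt hX (p := 1 + (1 + (1 + 2))) (q := 1 + (1 + (1 + 0)))
      (by norm_num) (by norm_num) (hCPT _ hκ11 (hCPT _ hκ11 (hCPT _ hκ11 hz20)))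
  obtain ⟨t, ht, heq⟩ := D.hodgeRiemann_X hX (a := 2) (s := 2) (t' := 0) (r₀ := 2) rfl
    (show (2 + 2 * 2) + 2 = 2 * 4 by norm_num) hz20 hσ0 hprim
  have hs : (Complex.I ^ (((2 : ℕ) : ℤ) - ((0 : ℕ) : ℤ)) * (-1 : ℂ) ^ (2 * (2 - 1) / 2)) = 1 := by
    rw [show ((2 : ℕ) : ℤ) - ((0 : ℕ) : ℤ) = 2 by norm_num, zpow_two, Complex.I_mul_I]
    norm_num
  rw [hs, one_smul] at heq
  refine ⟨t, ht, ?_⟩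
  rw [← cupProduct_lefschetzPow_two_eq_cupFour]
  exact heq

/-! ### Hodge–Riemann for `σ² ∈ H^{4,0}`: `σ² σ̄²` is a positive multiple of the volume class -/

/-- **`∫ σ² σ̄² > 0` if `σ² ≠ 0`** (Hodge–Riemann at `a = 4`, type `(4,0)`, `r₀ = 0`; `σ²` is primitive
because `κ σ²` has type `(5,1)`), in the `cupFour` spelling. [cite: VoisinHodgeI2002, §6.3.2 Thm. 6.32] -/
theorem cupFour_period_sq (hX : IsSmoothProjective 4 X)
    {φ : complexBetti X 2 ≃ₗ[ℂ] (K3HilbertIndex → ℂ)} {P : complexBetti X (2 * 4)} {z : K3HilbertIndex → ℂ}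
    (hM : MarkedK3Sq[X, φ, P, z]) (D : KaehlerRationalDatum 4 X)
    (hξ0 : cupProduct (rfl : 2 + 2 = 2 * 2) (φ.symm z) (φ.symm z) ≠ 0) :
    ∃ t : ℝ, 0 < t ∧ cupFour (φ.symm z) (φ.symm z) (conjClass (ComplexPoints X) 2 (φ.symm z))
      (conjClass (ComplexPoints X) 2 (φ.symm z)) = (t : ℂ) • D.topClass := by
  obtain ⟨-, -, -, hper, -, -⟩ := hM
  have hz20 : IsOfHodgeType 4 X 2 2 0 (φ.symm z) := hper.1
  have hCPT := BettiUniverse.cupPreservesHodgeType exists_isReal_hodgeModel_holds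
    hodgePQ_independent_of_hodgeModel_holds hX
  have hκ11 : IsOfHodgeType 4 X 2 1 1 D.Hη := D.isOfHodgeType_Hη
  -- (Hodge types are kept in the additive spelling `2 + 2`, `0 + 0` produced by `CupPreservesHodgeType`.)
  have hξ40 : IsOfHodgeType 4 X (2 * 2) (2 + 2) (0 + 0) (cupProduct (rfl : 2 + 2 = 2 * 2) (φ.symm z) (φ.symm z)) :=
    hCPT _ hz20 hz20
  have hprim : lefschetzPow D.Hη (0 + 1) (2 * 2) (cupProduct (rfl : 2 + 2 = 2 * 2) (φ.symm z) (φ.symm z)) = 0 := by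
    simp only [lefschetzPow_succ, lefschetzPow_zero, LinearMap.comp_apply, LinearMap.id_apply,
      lefschetzOperator_apply]
    exact eq_zero_of_isOfHodgeType_of_four_lt hX (p := 1 + (2 + 2)) (q := 1 + (0 + 0)) (by norm_num) (by norm_num)
      (hCPT _ hκ11 hξ40)
  obtain ⟨t, ht, heq⟩ := D.hodgeRiemann_X hX (a := 2 * 2) (s := 2 + 2) (t' := 0 + 0) (r₀ := 0) rfl
    (show (2 * 2 + 2 * 0) + 2 * 2 = 2 * 4 by norm_num) hξ40 hξ0 hprim
  have hs : (Complex.I ^ (((2 + 2 : ℕ) : ℤ) - ((0 + 0 : ℕ) : ℤ)) * (-1 : ℂ) ^ (2 * 2 * (2 * 2 - 1) / 2)) = 1 := by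
    rw [show ((2 + 2 : ℕ) : ℤ) - ((0 + 0 : ℕ) : ℤ) = 2 + 2 by norm_num, zpow_add₀ Complex.I_ne_zero, zpow_two,
      Complex.I_mul_I]
    norm_num
  rw [hs, one_smul, lefschetzPow_zero, LinearMap.id_apply, conjClass_cupProduct] at heq
  refine ⟨t, ht, ?_⟩
  have hassoc : cupFour (φ.symm z) (φ.symm z) (conjClass (ComplexPoints X) 2 (φ.symm z))
      (conjClass (ComplexPoints X) 2 (φ.symm z)) =
      cupProduct (show 2 * 2 + 2 * 2 = 2 * 4 by norm_num) (cupProduct (rfl : 2 + 2 = 2 * 2) (φ.symm z) (φ.symm z))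
        (cupProduct (rfl : 2 + 2 = 2 * 2) (conjClass (ComplexPoints X) 2 (φ.symm z))
          (conjClass (ComplexPoints X) 2 (φ.symm z))) := by
    rw [cupFour_def, cupProduct_assoc (rfl : 2 * 2 + 2 = 2 * 3) (rfl : 2 + 2 = 2 * 2)
      (rfl : 2 * 3 + 2 = 2 * 4) (show 2 * 2 + 2 * 2 = 2 * 4 by norm_num)]
  rw [hassoc]
  exact heq

/-! ### Extraction: `τ(P) > 0` and `q(κ) > 0` -/

/-- **Beauville–Fujiki positivity.** For a marked smooth projective fourfold `(X, φ, P, z)` (clauses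
(m1)–(m6)) and a Kähler–rational datum `D` with Kähler class `κ = H_η`: the trace `τ(P)` of the marking
generator and the Beauville–Bogomolov square `q(φκ, φκ)` of the Kähler class are POSITIVE REALS. Proof:
`κ²σσ̄ = q(κ)q(z,z̄)·P = t·Ω` and `σ²σ̄² = 2q(z,z̄)²·P = t'·Ω` with `t, t' > 0` (Hodge–Riemann), `q(z,z̄) > 0`
real (m6), `τ(Ω) > 0`; `q(κ)` is real because `κ` and the marking are real.
[cite: Beauville1983, §8 Thm. 5] [cite: VoisinHodgeI2002, §6.3.2 Thm. 6.32] -/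
theorem cTrace_pos_and_kaehler_pos (hX : IsSmoothProjective 4 X)
    {φ : complexBetti X 2 ≃ₗ[ℂ] (K3HilbertIndex → ℂ)} {P : complexBetti X (2 * 4)} {z : K3HilbertIndex → ℂ}
    (hM : MarkedK3Sq[X, φ, P, z]) (D : KaehlerRationalDatum 4 X) :
    (0 < (D.cTrace hX P).re ∧ (D.cTrace hX P).im = 0) ∧
      (0 < (k3HilbertForm 2 (φ D.Hη) (φ D.Hη)).re ∧ (k3HilbertForm 2 (φ D.Hη) (φ D.Hη)).im = 0) := by
  have hMK := isMarkedK3Hilb_of_marked hM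
  obtain ⟨t, ht, h1⟩ := cupFour_kaehler_period hX hM D
  obtain ⟨-, hint, -, hper, h11, hzz, hzpos⟩ := id hM
  have hκ11 : IsOfHodgeType 4 X 2 1 1 D.Hη := D.isOfHodgeType_Hη
  set σ := φ.symm z with hσdef
  set κ := D.Hη with hκdef
  have hφσ : φ σ = z := φ.apply_symm_apply z
  have hφσbar : φ (conjClass (ComplexPoints X) 2 σ) = star z := by rw [marking_conjClass hint, hφσ]
  obtain ⟨hκz, hκzbar⟩ := (h11 κ).1 hκ11
  -- the two polarised Fujiki evaluations
  set r : ℂ := k3HilbertForm 2 z (star z) with hrdef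
  set qκ : ℂ := k3HilbertForm 2 (φ κ) (φ κ) with hqκdef
  have hF1 : cupFour κ κ σ (conjClass (ComplexPoints X) 2 σ) = (qκ * r) • P := by
    rw [cupFour_eq_of_isMarkedK3Hilb hMK, hφσ, hφσbar, hκz, hκzbar]
    congr 1
    ring
  have hF2 : cupFour σ σ (conjClass (ComplexPoints X) 2 σ) (conjClass (ComplexPoints X) 2 σ) =
      (2 * r ^ 2) • P := by
    rw [cupFour_eq_of_isMarkedK3Hilb hMK, hφσ, hφσbar, hzz]
    congr 1
    ring
  -- reality of `r` and `qκ`; `r > 0`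
  have hr_im : r.im = 0 := k3HilbertForm_self_star_im z
  have hr_re : 0 < r.re := by rw [hrdef, k3HilbertForm_comm]; exact hzpos
  have hκreal : star (φ κ) = φ κ := by rw [← marking_conjClass hint, hκdef, D.conjClass_Hη]
  have hq_im : qκ.im = 0 := k3HilbertForm_im_eq_zero_of_star_eq hκreal hκreal
  obtain ⟨hT_re, hT_im⟩ := D.cTrace_topClass_pos hX
  have hr : r = ((r.re : ℝ) : ℂ) := Complex.ext (by simp) (by simp [hr_im])
  have hTr : D.cTrace hX D.topClass = (((D.cTrace hX D.topClass).re : ℝ) : ℂ) :=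
    Complex.ext (by simp) (by simp [hT_im])
  have hq : qκ = ((qκ.re : ℝ) : ℂ) := Complex.ext (by simp) (by simp [hq_im])
  have hr0 : ((r.re : ℝ) : ℂ) ≠ 0 := by exact_mod_cast hr_re.ne'
  -- `P ≠ 0` and `σ² ≠ 0` from the first relation
  rw [hF1] at h1
  have hP0 : P ≠ 0 := by
    intro hP
    rw [hP, smul_zero] at h1
    rcases smul_eq_zero.1 h1.symm with h | h
    · exact ht.ne' (by exact_mod_cast h)
    · exact D.topClass_ne_zero hX h
  have hξ0 : cupProduct (rfl : 2 + 2 = 2 * 2) σ σ ≠ 0 := by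
    intro h0
    have h := hF2
    rw [cupFour_def, h0, LinearMap.map_zero₂, LinearMap.map_zero₂] at h
    have h2r : (2 : ℂ) * r ^ 2 = 0 := by
      rcases smul_eq_zero.1 h.symm with h' | h'
      · exact h'
      · exact absurd h' hP0
    have hr00 : r = 0 := by
      rcases mul_eq_zero.1 h2r with h' | h'
      · norm_num at h'
      · exact (pow_eq_zero_iff two_ne_zero).1 h'
    rw [hr00, Complex.zero_re] at hr_re
    exact lt_irrefl _ hr_re
  obtain ⟨t₂, ht₂, h2⟩ := cupFour_period_sq hX hM D hξ0
  rw [hF2] at h2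
  -- traces of the two relations
  have e1 := congrArg (D.cTrace hX) h1
  have e2 := congrArg (D.cTrace hX) h2
  simp only [map_smul, smul_eq_mul] at e1 e2
  rw [hr, hq, hTr] at e1
  rw [hr, hTr] at e2
  -- `τ(P)` is the positive real `t₂ τ(Ω) / (2 q(z,z̄)²)`
  set T : ℂ := D.cTrace hX D.topClass with hTdef
  have hτP : D.cTrace hX P = ((t₂ * T.re / (2 * r.re ^ 2) : ℝ) : ℂ) := by
    have hne : ((2 * r.re ^ 2 : ℝ) : ℂ) ≠ 0 := by
      have : (0 : ℝ) < 2 * r.re ^ 2 := by positivity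
      exact_mod_cast this.ne'
    rw [Complex.ofReal_div, eq_div_iff hne]
    push_cast
    linear_combination e2
  have hτP_re : 0 < (D.cTrace hX P).re := by
    rw [hτP, Complex.ofReal_re]; positivity
  have hτP_im : (D.cTrace hX P).im = 0 := by rw [hτP, Complex.ofReal_im]
  -- `q(κ)` is the positive real `t τ(Ω) / (q(z,z̄) τ(P))`
  rw [hτP] at e1
  have hqκ : qκ = ((t * T.re / (r.re * (t₂ * T.re / (2 * r.re ^ 2))) : ℝ) : ℂ) := by
    have hne : ((r.re * (t₂ * T.re / (2 * r.re ^ 2)) : ℝ) : ℂ) ≠ 0 := by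
      have : (0 : ℝ) < r.re * (t₂ * T.re / (2 * r.re ^ 2)) := by positivity
      exact_mod_cast this.ne'
    rw [hq, Complex.ofReal_div, eq_div_iff hne]
    push_cast at e1 ⊢
    linear_combination e1
  refine ⟨⟨hτP_re, hτP_im⟩, ?_, hq_im⟩
  rw [hqκ, Complex.ofReal_re]
  positivity

/-! ### Hodge index for `q` on `(1,1)`-classes orthogonal to the Kähler class -/

/-- **Hodge index for the Beauville–Bogomolov form.** For a marked `(X, φ, P, z)`, a Kähler–rational datum
`D` (Kähler class `κ`), and a non-zero REAL class `d` of type `(1,1)` with `q(φκ, φd) = 0`: `q(φd, φd) < 0`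
(a real number). Proof: `κ³d = 3q(κ)q(κ,d)P = 0` (polarised Fujiki), so `d` is primitive and Hodge–Riemann
gives `∫κ²d² < 0`; `κ²d² = q(κ)q(d,d)P` with `q(κ), τ(P) > 0` (`cTrace_pos_and_kaehler_pos`).
[cite: VoisinHodgeI2002, §6.3.2 Thm. 6.32] [cite: Beauville1983, §8 Thm. 5] -/
theorem k3HilbertForm_self_neg_of_oneOne_of_kaehler_orthogonal (hX : IsSmoothProjective 4 X)
    {φ : complexBetti X 2 ≃ₗ[ℂ] (K3HilbertIndex → ℂ)} {P : complexBetti X (2 * 4)} {z : K3HilbertIndex → ℂ}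
    (hM : MarkedK3Sq[X, φ, P, z]) (D : KaehlerRationalDatum 4 X) {d : complexBetti X 2}
    (hd11 : IsOfHodgeType 4 X 2 1 1 d) (hdreal : conjClass (ComplexPoints X) 2 d = d) (hd0 : d ≠ 0)
    (horth : k3HilbertForm 2 (φ D.Hη) (φ d) = 0) :
    (k3HilbertForm 2 (φ d) (φ d)).re < 0 ∧ (k3HilbertForm 2 (φ d) (φ d)).im = 0 := by
  have hMK := isMarkedK3Hilb_of_marked hM
  obtain ⟨⟨hτ_re, hτ_im⟩, hq_re, hq_im⟩ := cTrace_pos_and_kaehler_pos hX hM D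
  obtain ⟨-, hint, -⟩ := id hM
  obtain ⟨hT_re, hT_im⟩ := D.cTrace_topClass_pos hX
  -- `κ³ d = 0`: `d` is primitive
  have hF3 : cupFour D.Hη D.Hη d D.Hη = 0 := by
    rw [cupFour_swap34, cupFour_eq_of_isMarkedK3Hilb hMK, horth]; simp
  have hprim : lefschetzPow D.Hη (2 + 1) 2 d = 0 := by
    rw [lefschetzPow_succ, LinearMap.comp_apply, lefschetzOperator_apply,
      cupProduct_gradedComm_holds ℂ _ _ (show (2 + 2 * 2) + 2 = 2 + 2 * (2 + 1) by norm_num)]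
    have h4 : cupProduct (show (2 + 2 * 2) + 2 = 2 + 2 * (2 + 1) by norm_num) (lefschetzPow D.Hη 2 2 d) D.Hη =
        cupFour D.Hη D.Hη d D.Hη := cupProduct_lefschetzPow_two_eq_cupFour D.Hη d D.Hη
    rw [h4, hF3, smul_zero]
  -- Hodge–Riemann for `d` (type `(1,1)`, sign `-1`)
  obtain ⟨t, ht, heq⟩ := D.hodgeRiemann_X hX (a := 2) (s := 1) (t' := 1) (r₀ := 2) rfl
    (show (2 + 2 * 2) + 2 = 2 * 4 by norm_num) hd11 hd0 hprim
  have hs : (Complex.I ^ (((1 : ℕ) : ℤ) - ((1 : ℕ) : ℤ)) * (-1 : ℂ) ^ (2 * (2 - 1) / 2)) = -1 := by norm_num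
  rw [hs, cupProduct_lefschetzPow_two_eq_cupFour, hdreal, cupFour_eq_of_isMarkedK3Hilb hMK, horth] at heq
  -- `-(q(κ) q(d,d)) τ(P) = t τ(Ω)`
  have e := congrArg (D.cTrace hX) heq
  simp only [map_smul, smul_eq_mul, mul_zero, add_zero] at e
  have hdstar : star (φ d) = φ d := by rw [← marking_conjClass hint, hdreal]
  have hqd_im : (k3HilbertForm 2 (φ d) (φ d)).im = 0 := k3HilbertForm_im_eq_zero_of_star_eq hdstar hdstar
  set qd := k3HilbertForm 2 (φ d) (φ d) with hqddef
  set qκ := k3HilbertForm 2 (φ D.Hη) (φ D.Hη) with hqκdef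
  have hqκ : qκ = ((qκ.re : ℝ) : ℂ) := Complex.ext (by simp) (by simp [hq_im])
  have hqd : qd = ((qd.re : ℝ) : ℂ) := Complex.ext (by simp) (by simp [hqd_im])
  have hτ : D.cTrace hX P = (((D.cTrace hX P).re : ℝ) : ℂ) := Complex.ext (by simp) (by simp [hτ_im])
  have hT : D.cTrace hX D.topClass = (((D.cTrace hX D.topClass).re : ℝ) : ℂ) :=
    Complex.ext (by simp) (by simp [hT_im])
  rw [hqκ, hqd, hτ, hT] at e
  have ereal : (-1 : ℝ) * (qκ.re * qd.re * (D.cTrace hX P).re) = t * (D.cTrace hX D.topClass).re := by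
    exact_mod_cast e
  refine ⟨?_, hqd_im⟩
  by_contra hge
  rw [not_lt] at hge
  have h1 : 0 ≤ qκ.re * qd.re * (D.cTrace hX P).re := by positivity
  have h2 : 0 < t * (D.cTrace hX D.topClass).re := by positivity
  linarith

end Summit.HodgeConjecture.HodgeConjecture.Theorems.MarkmanPartnerTransport.BBFPositivity

end
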